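import Literature.AlgebraicGeometry.Resolution.LogRefinedChartFace
import Literature.AlgebraicGeometry.Resolution.LogChartEmbeddedReduction
import Mathlib.LinearAlgebra.FreeModule.PID
import Mathlib.LinearAlgebra.Dimension.Free
import HarnessLib

/-!
# The torus coordinates and the refinement data at a point of a refined toric chart — Kato (10.3)

`Literature/AlgebraicGeometry/Resolution/LogRefinedChartTorus.lean`. Continuation of
`LogRefinedChartFace.lean` (K. Kato, *Toric singularities*, Amer. J. Math. 116 (1994), (10.3)):
at a prime `𝔓` of the chart algebra `C ⊇ A[χ(Q)]`, with unit indices `U` and face `F_𝔭`,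

* `hsub` — the subgroup `H_U = {x : bᵢ*(x) = 0, i ∉ U}` ⊇ `ℤF_𝔭`;
* `torusLattice = π₀(H_U)` (a complement of `ℤF_𝔭` in `H_U`), `torusBasis`, `torusCoord` —
  the coordinates `b′(x)` of `π₀(x − σ x)`, the exponents of the torus variables;
* `evalHom : A_𝔭[X₁..X_g] → C_𝔓` (`X_k ↦ χ(h′_k)`), `torusPrime = evalHom⁻¹(𝔪)`, the base change
  `A₁ = A_𝔭[X]_𝔮` of `LogRegularPolynomialBase.lean` and `rho : A₁ → C_𝔓`;
* `twistUnits` (`u(e p) = X^{b′(p)}`) and `refineMap` (`c(e p) = (bᵢ*(p))_{i ∉ U}`) with the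
  hypotheses of the refinement theorems (`u` multiplicative, `c` additive, kernel-free, finite
  fibres).

References: [Kato1994] K. Kato, Toric singularities, Amer. J. Math. 116 (1994), (10.3).
-/

noncomputable section

open IsLocalRing

namespace Literature.AlgebraicGeometry.Resolution

namespace LogRefinedChart

universe u

variable {n : ℕ} {A : Type u} [CommRing A] {P : AddSubmonoid (Fin n → ℤ)}
  {φ : Multiplicative P →* A} {C : Type u} [CommRing C] [Algebra A C]
  {Q : AddSubmonoid (Fin n → ℤ)} {b : Module.Basis (Fin n) ℤ (Fin n → ℤ)} {I : Finset (Fin n)}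
  (hQ : IsOrthantLike b I Q) (χ : Multiplicative Q →* C) (𝔓 : Ideal C) [𝔓.IsPrime]

/-! ### The subgroup `H_U` and the torus lattice -/

/-- **`H_U`**: vectors with vanishing non-unit coordinates. [cite: Kato1994, (10.3)] -/
def hsub : Submodule ℤ (Fin n → ℤ) where
  carrier := {x | ∀ i, i ∉ unitIdx hQ χ 𝔓 → b.repr x i = 0}
  zero_mem' := fun i _ => by rw [map_zero, Finsupp.zero_apply]
  add_mem' := fun {x y} hx hy i hi => by rw [map_add, Finsupp.add_apply, hx i hi, hy i hi, add_zero]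
  smul_mem' := fun c {x} hx i hi => by
    rw [map_zsmul, Finsupp.smul_apply, hx i hi, smul_zero]

/-- Membership in `H_U`. [cite: Kato1994, (10.3)] -/
theorem mem_hsub_iff {x : Fin n → ℤ} :
    x ∈ hsub hQ χ 𝔓 ↔ ∀ i, i ∉ unitIdx hQ χ 𝔓 → b.repr x i = 0 := Iff.rfl

/-- `x − σ x ∈ H_U`. [cite: Kato1994, (10.3)] -/
theorem sub_sigma_mem_hsub (x : Fin n → ℤ) : x - sigma hQ χ 𝔓 x ∈ hsub hQ χ 𝔓 :=
  fun _ hi => repr_sub_sigma_eq_zero hQ χ 𝔓 x hi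

variable (hPQ : P ≤ Q)
  (hχ : ∀ p : P, χ (Multiplicative.ofAdd ⟨(p : Fin n → ℤ), hPQ p.2⟩) =
    algebraMap A C (φ (Multiplicative.ofAdd p)))

include hχ in
/-- The face group lies in `H_U`. [cite: Kato1994, (5.1), (10.3)] -/
theorem span_faceMonoid_le_hsub :
    Submodule.span ℤ (LogChart.faceMonoid P φ (𝔓.comap (algebraMap A C)) : Set (Fin n → ℤ)) ≤
      hsub hQ χ 𝔓 := by
  rw [Submodule.span_le]
  intro f hf i hi
  exact repr_eq_zero_of_mem_faceMonoid hQ χ 𝔓 hPQ hχ hf hi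

variable (π₀ : (Fin n → ℤ) →ₗ[ℤ] (Fin n → ℤ))
  (hπ₀1 : ∀ v, v - π₀ v ∈ Submodule.span ℤ
    (LogChart.faceMonoid P φ (𝔓.comap (algebraMap A C)) : Set (Fin n → ℤ)))
  (hπ₀2 : ∀ v, π₀ (π₀ v) = π₀ v)

/-- **The torus lattice** `π₀(H_U)`, a complement of the face group in `H_U`.
[cite: Kato1994, (10.3)] -/
def torusLattice : Submodule ℤ (Fin n → ℤ) := (hsub hQ χ 𝔓).map π₀

/-- The torus lattice is a free `ℤ`-module (a subgroup of `ℤⁿ`). [cite: Kato1994, (10.3)] -/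
instance torusLattice.free : Module.Free ℤ (torusLattice hQ χ 𝔓 π₀) :=
  Module.Free.of_basis (Submodule.basisOfPid (Pi.basisFun ℤ (Fin n))
    (torusLattice hQ χ 𝔓 π₀)).2

/-- The torus lattice is finitely generated. [cite: Kato1994, (10.3)] -/
instance torusLattice.finite : Module.Finite ℤ (torusLattice hQ χ 𝔓 π₀) :=
  Module.Finite.of_basis (Submodule.basisOfPid (Pi.basisFun ℤ (Fin n))
    (torusLattice hQ χ 𝔓 π₀)).2

/-- The rank `g` of the torus lattice (number of torus variables). [cite: Kato1994, (10.3)] -/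
def torusRank : ℕ := Module.finrank ℤ (torusLattice hQ χ 𝔓 π₀)

/-- A `ℤ`-basis `h′₁, …, h′_g` of the torus lattice. [cite: Kato1994, (10.3)] -/
def torusBasis : Module.Basis (Fin (torusRank hQ χ 𝔓 π₀)) ℤ (torusLattice hQ χ 𝔓 π₀) :=
  Module.finBasis ℤ (torusLattice hQ χ 𝔓 π₀)

/-- `π₀ (x − σ x)` lies in the torus lattice. [cite: Kato1994, (10.3)] -/
theorem proj_sub_sigma_mem (x : Fin n → ℤ) : π₀ (x - sigma hQ χ 𝔓 x) ∈ torusLattice hQ χ 𝔓 π₀ :=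
  Submodule.mem_map_of_mem (sub_sigma_mem_hsub hQ χ 𝔓 x)

/-- **The torus coordinates** `b′(x)` = coordinates of `π₀(x − σ x)` in the basis `h′`.
[cite: Kato1994, (10.3)] -/
def torusCoord : (Fin n → ℤ) →ₗ[ℤ] (Fin (torusRank hQ χ 𝔓 π₀) →₀ ℤ) :=
  (torusBasis hQ χ 𝔓 π₀).repr.toLinearMap ∘ₗ
    LinearMap.codRestrict (torusLattice hQ χ 𝔓 π₀) (π₀ ∘ₗ (LinearMap.id - sigma hQ χ 𝔓))
      (fun x => proj_sub_sigma_mem hQ χ 𝔓 π₀ x)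

/-- `b′` unfolded. [cite: Kato1994, (10.3)] -/
theorem torusCoord_apply (x : Fin n → ℤ) :
    torusCoord hQ χ 𝔓 π₀ x =
      (torusBasis hQ χ 𝔓 π₀).repr ⟨π₀ (x - sigma hQ χ 𝔓 x), proj_sub_sigma_mem hQ χ 𝔓 π₀ x⟩ :=
  rfl

/-- Recombining the torus coordinates gives back `π₀(x − σ x)`. [cite: Kato1994, (10.3)] -/
theorem sum_torusCoord_smul (x : Fin n → ℤ) :
    ∑ k, torusCoord hQ χ 𝔓 π₀ x k • ((torusBasis hQ χ 𝔓 π₀ k : torusLattice hQ χ 𝔓 π₀) :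
      Fin n → ℤ) = π₀ (x - sigma hQ χ 𝔓 x) := by
  have h := (torusBasis hQ χ 𝔓 π₀).sum_repr
    ⟨π₀ (x - sigma hQ χ 𝔓 x), proj_sub_sigma_mem hQ χ 𝔓 π₀ x⟩
  have h' := congrArg (fun y : torusLattice hQ χ 𝔓 π₀ => (y : Fin n → ℤ)) h
  simp only [Submodule.coe_sum, Submodule.coe_smul_of_tower] at h'
  rw [torusCoord_apply]
  exact h'

include hχ in
/-- `b′` kills the face group. [cite: Kato1994, (5.1), (10.3)] -/
theorem torusCoord_eq_zero_of_mem_span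
    (hπ₀0 : ∀ v ∈ Submodule.span ℤ
      (LogChart.faceMonoid P φ (𝔓.comap (algebraMap A C)) : Set (Fin n → ℤ)), π₀ v = 0)
    {v : Fin n → ℤ}
    (hv : v ∈ Submodule.span ℤ
      (LogChart.faceMonoid P φ (𝔓.comap (algebraMap A C)) : Set (Fin n → ℤ))) :
    torusCoord hQ χ 𝔓 π₀ v = 0 := by
  rw [torusCoord_apply, LinearEquiv.map_eq_zero_iff]
  apply Subtype.ext
  show π₀ (v - sigma hQ χ 𝔓 v) = 0
  rw [sigma_eq_zero_of_mem_span hQ χ 𝔓 hPQ hχ hv, sub_zero, hπ₀0 v hv]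

include hπ₀1 hπ₀2 hχ in
/-- Elements of the torus lattice: in `H_U` and fixed by `π₀`, hence `b′(y) = ` their
coordinates. [cite: Kato1994, (10.3)] -/
theorem torusCoord_coe (y : torusLattice hQ χ 𝔓 π₀) :
    torusCoord hQ χ 𝔓 π₀ (y : Fin n → ℤ) = (torusBasis hQ χ 𝔓 π₀).repr y := by
  obtain ⟨y, hy⟩ := y
  obtain ⟨h, hh, rfl⟩ := Submodule.mem_map.1 hy
  rw [torusCoord_apply]
  congr 1
  apply Subtype.ext
  show π₀ (π₀ h - sigma hQ χ 𝔓 (π₀ h)) = π₀ h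
  have hmem : π₀ h ∈ hsub hQ χ 𝔓 := by
    have : π₀ h = h - (h - π₀ h) := (sub_sub_cancel h (π₀ h)).symm
    rw [this]
    exact Submodule.sub_mem _ hh (span_faceMonoid_le_hsub hQ χ 𝔓 hPQ hχ (hπ₀1 h))
  rw [sigma_eq_zero_of_repr hQ χ 𝔓 fun i hi => hmem i hi, sub_zero, hπ₀2]

include hπ₀1 hχ in
/-- The torus lattice lies in `H_U`. [cite: Kato1994, (10.3)] -/
theorem torusLattice_le_hsub : torusLattice hQ χ 𝔓 π₀ ≤ hsub hQ χ 𝔓 := by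
  rintro _ ⟨h, hh, rfl⟩
  have : π₀ h = h - (h - π₀ h) := (sub_sub_cancel h (π₀ h)).symm
  rw [this]
  exact Submodule.sub_mem _ hh (span_faceMonoid_le_hsub hQ χ 𝔓 hPQ hχ (hπ₀1 h))

/-! ### The torus base change `A₁ = A_𝔭[X]_𝔮` and `ρ : A₁ → C_𝔓` -/

variable (A)

/-- The local ring `A_𝔭` of the base at `𝔭 = 𝔓 ∩ A`. [cite: Kato1994, (10.3)] -/
abbrev BaseLoc : Type u := Localization.AtPrime (𝔓.comap (algebraMap A C))

/-- The local map `ρ₀ : A_𝔭 → C_𝔓`. [cite: Kato1994, (10.3)] -/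
def rho₀ : BaseLoc A 𝔓 →+* Localization.AtPrime 𝔓 :=
  Localization.localRingHom (𝔓.comap (algebraMap A C)) 𝔓 (algebraMap A C) rfl

/-- `ρ₀` is local. [cite: Kato1994, (10.3)] -/
instance isLocalHom_rho₀ : IsLocalHom (rho₀ A 𝔓) :=
  Localization.isLocalHom_localRingHom _ _ _ _

/-- `ρ₀` on `A`. [cite: Kato1994, (10.3)] -/
theorem rho₀_algebraMap (a : A) :
    rho₀ A 𝔓 (algebraMap A (BaseLoc A 𝔓) a) =
      algebraMap C (Localization.AtPrime 𝔓) (algebraMap A C a) :=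
  Localization.localRingHom_to_map _ _ _ rfl a

/-- The polynomial ring `A_𝔭[X₁, …, X_g]` of the torus variables. [cite: Kato1994, (10.3)] -/
abbrev TorusPoly : Type u := MvPolynomial (Fin (torusRank hQ χ 𝔓 π₀)) (BaseLoc A 𝔓)

/-- **The evaluation** `A_𝔭[X₁, …, X_g] → C_𝔓`, `X_k ↦ χ(h′_k)` (the unit part of the `k`-th torus
basis vector). [cite: Kato1994, (10.3)] -/
def evalHom : TorusPoly A hQ χ 𝔓 π₀ →+* Localization.AtPrime 𝔓 :=
  MvPolynomial.eval₂Hom (rho₀ A 𝔓)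
    fun k => ((Additive.toMul (unitPartAt hQ χ 𝔓
      ((torusBasis hQ χ 𝔓 π₀ k : torusLattice hQ χ 𝔓 π₀) : Fin n → ℤ)) :
        (Localization.AtPrime 𝔓)ˣ) : Localization.AtPrime 𝔓)

/-- `evalHom` on constants. [cite: Kato1994, (10.3)] -/
@[simp] theorem evalHom_C (a : BaseLoc A 𝔓) :
    evalHom A hQ χ 𝔓 π₀ (MvPolynomial.C a) = rho₀ A 𝔓 a :=
  MvPolynomial.eval₂Hom_C _ _ a

/-- `evalHom` on variables. [cite: Kato1994, (10.3)] -/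
@[simp] theorem evalHom_X (k : Fin (torusRank hQ χ 𝔓 π₀)) :
    evalHom A hQ χ 𝔓 π₀ (MvPolynomial.X k) =
      ((Additive.toMul (unitPartAt hQ χ 𝔓
        ((torusBasis hQ χ 𝔓 π₀ k : torusLattice hQ χ 𝔓 π₀) : Fin n → ℤ)) :
          (Localization.AtPrime 𝔓)ˣ) : Localization.AtPrime 𝔓) :=
  MvPolynomial.eval₂Hom_X' _ _ k

/-- **The torus prime** `𝔮 = evalHom⁻¹(𝔪_{C_𝔓})`. [cite: Kato1994, (10.3)] -/
def torusPrime : Ideal (TorusPoly A hQ χ 𝔓 π₀) :=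
  (maximalIdeal (Localization.AtPrime 𝔓)).comap (evalHom A hQ χ 𝔓 π₀)

/-- `𝔮` is prime. [cite: Kato1994, (10.3)] -/
instance isPrime_torusPrime : (torusPrime A hQ χ 𝔓 π₀).IsPrime := Ideal.IsPrime.comap _

/-- Membership in `𝔮`. [cite: Kato1994, (10.3)] -/
theorem mem_torusPrime_iff {f : TorusPoly A hQ χ 𝔓 π₀} :
    f ∈ torusPrime A hQ χ 𝔓 π₀ ↔ ¬IsUnit (evalHom A hQ χ 𝔓 π₀ f) := by
  rw [torusPrime, Ideal.mem_comap, mem_maximalIdeal, mem_nonunits_iff]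

/-- `𝔮 ∩ A_𝔭 = 𝔪_{A_𝔭}` (`ρ₀` is local). [cite: Kato1994, (10.3)] -/
theorem torusPrime_comap_C :
    (torusPrime A hQ χ 𝔓 π₀).comap MvPolynomial.C = maximalIdeal (BaseLoc A 𝔓) := by
  ext a
  rw [Ideal.mem_comap, mem_torusPrime_iff, evalHom_C, mem_maximalIdeal, mem_nonunits_iff,
    isUnit_map_iff]

/-- The local ring `A₁ = A_𝔭[X]_𝔮` of the torus fibre. [cite: Kato1994, (10.3)] -/
abbrev TorusLoc : Type u := Localization.AtPrime (torusPrime A hQ χ 𝔓 π₀)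

/-- **`ρ : A₁ = A_𝔭[X]_𝔮 → C_𝔓`**, the localisation of `evalHom`. [cite: Kato1994, (10.3)] -/
def rho : TorusLoc A hQ χ 𝔓 π₀ →+* Localization.AtPrime 𝔓 :=
  IsLocalization.lift (M := (torusPrime A hQ χ 𝔓 π₀).primeCompl)
    (S := TorusLoc A hQ χ 𝔓 π₀) (g := evalHom A hQ χ 𝔓 π₀)
    fun s => not_not.1 ((mem_torusPrime_iff A hQ χ 𝔓 π₀).not.1 s.2)

/-- `ρ` extends `evalHom`. [cite: Kato1994, (10.3)] -/
@[simp] theorem rho_algebraMap (f : TorusPoly A hQ χ 𝔓 π₀) :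
    rho A hQ χ 𝔓 π₀ (algebraMap (TorusPoly A hQ χ 𝔓 π₀) (TorusLoc A hQ χ 𝔓 π₀) f) =
      evalHom A hQ χ 𝔓 π₀ f :=
  IsLocalization.lift_eq _ f

/-- `ρ` is a local homomorphism. [cite: Kato1994, (10.3)] -/
instance isLocalHom_rho : IsLocalHom (rho A hQ χ 𝔓 π₀) := by
  refine ⟨fun x hx => ?_⟩
  obtain ⟨⟨f, s⟩, hfs⟩ := IsLocalization.surj (torusPrime A hQ χ 𝔓 π₀).primeCompl x
  -- `x * s = f` in `A₁`
  have hs : IsUnit (algebraMap (TorusPoly A hQ χ 𝔓 π₀) (TorusLoc A hQ χ 𝔓 π₀) (s : TorusPoly A hQ χ 𝔓 π₀)) :=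
    IsLocalization.map_units _ s
  have hf : IsUnit (evalHom A hQ χ 𝔓 π₀ f) := by
    have := congrArg (rho A hQ χ 𝔓 π₀) hfs
    rw [map_mul, rho_algebraMap, rho_algebraMap] at this
    rw [← this]
    exact hx.mul (not_not.1 ((mem_torusPrime_iff A hQ χ 𝔓 π₀).not.1 s.2))
  have hf' : IsUnit (algebraMap (TorusPoly A hQ χ 𝔓 π₀) (TorusLoc A hQ χ 𝔓 π₀) f) :=
    IsLocalization.map_units _ (⟨f, (mem_torusPrime_iff A hQ χ 𝔓 π₀).not.2 (not_not.2 hf)⟩ :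
      (torusPrime A hQ χ 𝔓 π₀).primeCompl)
  -- `x = f * s⁻¹`
  have hx' : x = algebraMap _ (TorusLoc A hQ χ 𝔓 π₀) f * ↑hs.unit⁻¹ := by
    rw [← hfs, mul_assoc, IsUnit.mul_val_inv, mul_one]
  rw [hx']
  exact hf'.mul (Units.isUnit _)

/-- The variables `X_k` lie outside `𝔮`. [cite: Kato1994, (10.3)] -/
theorem X_not_mem_torusPrime (k : Fin (torusRank hQ χ 𝔓 π₀)) :
    (MvPolynomial.X k : TorusPoly A hQ χ 𝔓 π₀) ∉ torusPrime A hQ χ 𝔓 π₀ := by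
  rw [mem_torusPrime_iff, not_not, evalHom_X]
  exact Units.isUnit _

/-- The variables `X_k` are units in `A₁`. [cite: Kato1994, (10.3)] -/
theorem isUnit_algebraMap_X (k : Fin (torusRank hQ χ 𝔓 π₀)) :
    IsUnit (algebraMap (TorusPoly A hQ χ 𝔓 π₀) (TorusLoc A hQ χ 𝔓 π₀) (MvPolynomial.X k)) :=
  IsLocalization.map_units (TorusLoc A hQ χ 𝔓 π₀)
    (⟨MvPolynomial.X k, X_not_mem_torusPrime A hQ χ 𝔓 π₀ k⟩ : (torusPrime A hQ χ 𝔓 π₀).primeCompl)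

/-- The unit `X_k ∈ A₁ˣ`. [cite: Kato1994, (10.3)] -/
def xUnit (k : Fin (torusRank hQ χ 𝔓 π₀)) : (TorusLoc A hQ χ 𝔓 π₀)ˣ :=
  (isUnit_algebraMap_X A hQ χ 𝔓 π₀ k).unit

/-- The unit `X_k` is the variable. [cite: Kato1994, (10.3)] -/
theorem coe_xUnit (k : Fin (torusRank hQ χ 𝔓 π₀)) :
    ((xUnit A hQ χ 𝔓 π₀ k : (TorusLoc A hQ χ 𝔓 π₀)ˣ) : TorusLoc A hQ χ 𝔓 π₀) =
      algebraMap (TorusPoly A hQ χ 𝔓 π₀) (TorusLoc A hQ χ 𝔓 π₀) (MvPolynomial.X k) :=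
  IsUnit.unit_spec _

/-- `ρ(X_k) = χ(h′_k)`. [cite: Kato1994, (10.3)] -/
theorem rho_xUnit (k : Fin (torusRank hQ χ 𝔓 π₀)) :
    rho A hQ χ 𝔓 π₀ (xUnit A hQ χ 𝔓 π₀ k : TorusLoc A hQ χ 𝔓 π₀) =
      ((Additive.toMul (unitPartAt hQ χ 𝔓
        ((torusBasis hQ χ 𝔓 π₀ k : torusLattice hQ χ 𝔓 π₀) : Fin n → ℤ)) :
          (Localization.AtPrime 𝔓)ˣ) : Localization.AtPrime 𝔓) := by
  rw [coe_xUnit, rho_algebraMap, evalHom_X]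

/-! ### The twisting units `u = X^{b′}` -/

/-- **The torus monomial** `X^{b′(x)} ∈ A₁ˣ` of a vector `x ∈ ℤⁿ`. [cite: Kato1994, (10.3)] -/
def torusMonomial : (Fin n → ℤ) →+ Additive (TorusLoc A hQ χ 𝔓 π₀)ˣ where
  toFun x := ∑ k, torusCoord hQ χ 𝔓 π₀ x k • Additive.ofMul (xUnit A hQ χ 𝔓 π₀ k)
  map_zero' := by simp
  map_add' x y := by
    rw [← Finset.sum_add_distrib]
    refine Finset.sum_congr rfl fun k _ => ?_
    rw [map_add, Finsupp.add_apply, add_zsmul]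

/-- `torusMonomial` unfolded. [cite: Kato1994, (10.3)] -/
theorem torusMonomial_apply (x : Fin n → ℤ) :
    torusMonomial A hQ χ 𝔓 π₀ x =
      ∑ k, torusCoord hQ χ 𝔓 π₀ x k • Additive.ofMul (xUnit A hQ χ 𝔓 π₀ k) := rfl

/-- `ρ(X_k) = χ(h′_k)` as units. [cite: Kato1994, (10.3)] -/
theorem units_map_rho_xUnit (k : Fin (torusRank hQ χ 𝔓 π₀)) :
    Units.map (rho A hQ χ 𝔓 π₀ : TorusLoc A hQ χ 𝔓 π₀ →* Localization.AtPrime 𝔓)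
        (xUnit A hQ χ 𝔓 π₀ k) =
      Additive.toMul (unitPartAt hQ χ 𝔓
        ((torusBasis hQ χ 𝔓 π₀ k : torusLattice hQ χ 𝔓 π₀) : Fin n → ℤ)) := by
  ext
  rw [Units.coe_map, MonoidHom.coe_coe, rho_xUnit]

/-- `ρ(X^{b′(x)}) = unit part of π₀(x − σ x)`, as units. [cite: Kato1994, (10.3)] -/
theorem units_map_rho_torusMonomial (x : Fin n → ℤ) :
    Units.map (rho A hQ χ 𝔓 π₀ : TorusLoc A hQ χ 𝔓 π₀ →* Localization.AtPrime 𝔓)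
        (Additive.toMul (torusMonomial A hQ χ 𝔓 π₀ x)) =
      Additive.toMul (unitPartAt hQ χ 𝔓 (π₀ (x - sigma hQ χ 𝔓 x))) := by
  rw [← sum_torusCoord_smul hQ χ 𝔓 π₀ x, map_sum, torusMonomial_apply]
  simp only [map_zsmul, toMul_sum, toMul_zsmul, toMul_ofMul, map_prod, map_zpow,
    units_map_rho_xUnit]

/-- `ρ(X^{−b′(x)}) = (unit part of π₀(x − σ x))⁻¹` in `C_𝔓`. [cite: Kato1994, (10.3)] -/
theorem rho_inv_torusMonomial (x : Fin n → ℤ) :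
    rho A hQ χ 𝔓 π₀ ((Additive.toMul (torusMonomial A hQ χ 𝔓 π₀ x))⁻¹ :
        (TorusLoc A hQ χ 𝔓 π₀)ˣ) =
      (((Additive.toMul (unitPartAt hQ χ 𝔓 (π₀ (x - sigma hQ χ 𝔓 x))))⁻¹ :
        (Localization.AtPrime 𝔓)ˣ) : Localization.AtPrime 𝔓) := by
  rw [← units_map_rho_torusMonomial A hQ χ 𝔓 π₀ x, Units.coe_map_inv, MonoidHom.coe_coe]

/-- `ρ(X^{b′(x)}) = unit part of π₀(x − σ x)` in `C_𝔓`. [cite: Kato1994, (10.3)] -/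
theorem rho_torusMonomial (x : Fin n → ℤ) :
    rho A hQ χ 𝔓 π₀ ((Additive.toMul (torusMonomial A hQ χ 𝔓 π₀ x) :
        (TorusLoc A hQ χ 𝔓 π₀)ˣ) : TorusLoc A hQ χ 𝔓 π₀) =
      ((Additive.toMul (unitPartAt hQ χ 𝔓 (π₀ (x - sigma hQ χ 𝔓 x))) :
        (Localization.AtPrime 𝔓)ˣ) : Localization.AtPrime 𝔓) := by
  rw [← units_map_rho_torusMonomial A hQ χ 𝔓 π₀ x, Units.coe_map, MonoidHom.coe_coe]

end LogRefinedChart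

end Literature.AlgebraicGeometry.Resolution
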